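import Mathlib
import HarnessLib
import Summits.NavierStokesRegularity.NavierStokesRegularity.Theorems.PoloidalWindowDoorLrcModEntireRidgeHullIterate
import Summits.NavierStokesRegularity.NavierStokesRegularity.Theorems.PoloidalWindowDoorLrcModEntireRidgeHullSup
import Summits.NavierStokesRegularity.NavierStokesRegularity.Theorems.PoloidalWindowDoorLrcModEntireRidgeQuasiconvexOpen

/-!
# Item `LrcModEntire` (stmt-NavierStokesRegularity-20428) — (Q3∞): ONE hull limit along an escaping sequence of base points makes the CROSS-SECTION MAXIMUM of the ridge
# CONSTANT along the limit branch, SIMULTANEOUSLY for all nearby times and heights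

ns-k2-port-2 g5 (helper prover under the LEAD of item 20428, ns-poloidal-K2-p3 g14; `--supports stmt-NavierStokesRegularity-20428 --as helper`).
Memo `Cruxes/LrcModEntire/T2B-g14.md` §13b «TARGET (Q3∞)»: `∃ U* ∈ Hull_Γ(v)` (pinned, peakless, same `N`, hot critical smooth branch `Γ*` through `0`, `κ ≥ κ₀`) with
`𝓡_{U*}(s; τ, z) := max_{|n| ≤ r} σU*₂(−1+τ, Γ*(s) + n ν_{Γ*}(s) + z e₂) = 𝓡₀(τ, z)` for ALL `s ∈ ℝ` and all `|τ|, |z| < δ`.  PROVED HERE with `U* :=` ANY hull limit along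
base parameters `s_k → +∞` (no Birkhoff element, no diagonal over `(τ,z)`): for each fixed `(τ,z)` the observable `s ↦ 𝓡_v(s;τ,z)` is quasiconvex on every parameter interval
(chart-free (Q1) `…RidgeQuasiconvexOpen.crossSectionMax_quasiconvexOn_of_isOpen`, the planar tube map of the complete branch being open for `r·(C₃/κ₀) < 1` by the curvature bound
`…RidgeBranchCurvature`) and bounded (Type-I extremality), hence has a limit at `+∞` (`…RidgeHullIterate.exists_tendsto_ridgeCoeff`); along the hull subsequence the shifted
observables converge to `𝓡_U(s;τ,z)` for EVERY `(τ,z)` (`…RidgeHullSup.tendsto_crossSectionMax`); so `…RidgeHullTools.eq_lim_of_tendsto_shift` gives the constancy.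

* `exists_hullLimit_crossSectionMax_const` — hypotheses: class clauses + Peakless (unfolded as in `hullLimit`), a sign `σ`, a COMPLETE `C²` hot branch `γ ⊂ P₀` of unit speed with
  in-plane normal `ν`, uniform non-degeneracy `κ₀`, the KNSS slice bound `‖D³v(−1)‖ ≤ C₃`, a tube radius `0 < r` with `r·(C₃/κ₀) < 1`, and the UNIFORM lateral-level data
  (U-LL): `δ ∈ (0, 1/2]` and levels `m τ z` with `σv₂(−1+τ, γ s ± rν s + z e₂) < m τ z ≤ σv₂(−1+τ, γ s + z e₂)` for ALL `s ∈ ℝ`, `|τ|,|z| < δ` (the LEAD's (LL) made uniform along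
  the branch — an input); base parameters `s_k → +∞`.  Conclusion: `∃ φ U Γ` — hull limit with the RE-ENTRY package of `…RidgeHullIterate` (critical hot set, `Γ ∈ C^∞`, unit
  speed in `P₀`, hot, `κ₀`-non-degenerate) — and **`∀ |τ|,|z| < δ, ∃ 𝓡₀, ∀ s, sSup ((n ↦ σU₂(−1+τ, Γ s + n ν_Γ s + z e₂)) '' [−r,r]) = 𝓡₀`**.

WHAT THIS IS NOT: not a claim about Navier–Stokes regularity — the entrance of the research cell (Q4) «HOMOGENEOUS NULL RIDGE» for hypothetical profiles, modulo the uniform (LL) input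
(bears_on LADDER-NS N0, item 20428 / crux 19708; 20428/19708/27893 OPEN; (Q4) OPEN).  No summit statement is proved here.
-/

noncomputable section

-- the summit and its single sub-problem share the name (CONVENTIONS §1), as in every Theorems file
set_option linter.dupNamespace false

namespace Summit.NavierStokesRegularity.NavierStokesRegularity.Theorems.PoloidalWindowDoorLrcModEntireRidgeHullValues

open Set Filter Topology Metric Function
open scoped ContDiff InnerProductSpace RealInnerProductSpace Laplacian
open Literature.Analysis Literature.Analysis.FluidPDE
open Summit.NavierStokesRegularity.NavierStokesRegularity.Theorems.LocalSineTubeDoorProfileAlignedWindowRigidityAncient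
open Summit.NavierStokesRegularity.NavierStokesRegularity.Theorems.PoloidalWindowDoorPoloidalWindowRigidityHotHullCompactness
open Summit.NavierStokesRegularity.NavierStokesRegularity.Theorems.PoloidalWindowDoorLrcModEntireRidgeClass
open Summit.NavierStokesRegularity.NavierStokesRegularity.Theorems.PoloidalWindowDoorLrcModEntireRidgeHullTools
open Summit.NavierStokesRegularity.NavierStokesRegularity.Theorems.PoloidalWindowDoorLrcModEntireRidgeBranchCurvature
open Summit.NavierStokesRegularity.NavierStokesRegularity.Theorems.PoloidalWindowDoorLrcModEntireRidgeHull
open Summit.NavierStokesRegularity.NavierStokesRegularity.Theorems.PoloidalWindowDoorLrcModEntireRidgeHullIterate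
open Summit.NavierStokesRegularity.NavierStokesRegularity.Theorems.PoloidalWindowDoorLrcModEntireRidgeHullSup
open Summit.NavierStokesRegularity.NavierStokesRegularity.Theorems.PoloidalWindowDoorLrcModEntireRidgeQuasiconvexOpen

/-- **(Q3∞) THE CROSS-SECTION MAXIMUM IS HOMOGENEOUS ALONG THE LIMIT BRANCH OF A HULL LIMIT, for all nearby times and heights at once.**  See the module docstring. -/
theorem exists_hullLimit_crossSectionMax_const (C : ℝ) (v : ℝ → EuclideanSpace ℝ (Fin 3) → EuclideanSpace ℝ (Fin 3))
    (hP : (Literature.Analysis.FluidPDE.HasTypeITimeDecay C v ∧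
        ContinuousOn (Function.uncurry v) (Set.Iio (0 : ℝ) ×ˢ Set.univ) ∧
        (∀ s t : ℝ, s < t → t < 0 → ∀ x, v t x =
          Literature.Analysis.UnboundedOperators.heatExtension (v s) (t - s) x -
            Literature.Analysis.FluidPDE.oseenDuhamel 1 s v v t x) ∧
        (∀ t < 0, Literature.Analysis.FluidPDE.VectorCalculus.IsDivFree (v t)) ∧
        (∀ s < 0, ∀ q, ⟪Literature.Analysis.FluidPDE.curl (v s) q, EuclideanSpace.single 2 1⟫_ℝ = 0) ∧
        v (-1) 0 2 ≠ 0 ∧ (∀ t < 0, ∀ x, Real.sqrt (-t) * |v t x 2| ≤ |v (-1) 0 2|) ∧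
        (∀ h : EuclideanSpace ℝ (Fin 3), fderiv ℝ (v (-1)) 0 h 2 = 0) ∧
        (deriv (fun s => v s 0 2) (-1) = v (-1) 0 2 / 2 ∧ v (-1) 0 2 * (Δ (fun q => v (-1) q 2)) 0 ≤ 0)))
    (hK : (∀ (s z₀ σ M : ℝ) (K O : Set (EuclideanSpace ℝ (Fin 3))), s < 0 →
        ((σ = 1 ∨ σ = -1) ∧ IsCompact K ∧ K.Nonempty ∧ (∀ q ∈ K, q 2 = z₀ ∧ σ * v s q 2 = M) ∧
          IsOpen O ∧ K ⊆ O ∧ (∀ q ∈ O, q 2 = z₀ → σ * v s q 2 ≤ M) ∧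
          (∀ q ∈ O, q 2 = z₀ → σ * v s q 2 = M → q ∈ K)) → False))
    {σ : ℝ} (hσ : σ = 1 ∨ σ = -1)
    {γ : ℝ → EuclideanSpace ℝ (Fin 3)} (hγ2 : ContDiff ℝ 2 γ) (hplane : ∀ s, γ s 2 = 0) (hunit : ∀ s, ‖deriv γ s‖ = 1)
    (hhot : ∀ s, v (-1) (γ s) 2 = v (-1) 0 2)
    {ν : ℝ → EuclideanSpace ℝ (Fin 3)} (hν : ∀ s, ν s = WithLp.toLp 2 ![-(deriv γ s 1), deriv γ s 0, 0])
    {κ₀ : ℝ} (hκ₀ : 0 < κ₀) (hκ : ∀ s, κ₀ ≤ -(fderiv ℝ (fderiv ℝ (fun y => σ * v (-1) y 2)) (γ s) (ν s) (ν s)))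
    {C₃ : ℝ} (hC₃ : ∀ x, ‖iteratedFDeriv ℝ 3 (v (-1)) x‖ ≤ C₃)
    {r : ℝ} (hr : 0 < r) (hrB : r * (C₃ / κ₀) < 1)
    {δ : ℝ} (hδ1 : δ ≤ 1 / 2) {m : ℝ → ℝ → ℝ}
    (hlat : ∀ τ z : ℝ, |τ| < δ → |z| < δ → ∀ s : ℝ, ∀ n : ℝ, (n = r ∨ n = -r) →
      σ * v (-1 + τ) (γ s + n • ν s + z • EuclideanSpace.single 2 1) 2 < m τ z)
    (hmid : ∀ τ z : ℝ, |τ| < δ → |z| < δ → ∀ s : ℝ, m τ z ≤ σ * v (-1 + τ) (γ s + z • EuclideanSpace.single 2 1) 2)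
    {sq : ℕ → ℝ} (hsq : Tendsto sq atTop atTop) :
    ∃ (φ : ℕ → ℕ) (U : ℝ → EuclideanSpace ℝ (Fin 3) → EuclideanSpace ℝ (Fin 3)) (Γ : ℝ → EuclideanSpace ℝ (Fin 3)), StrictMono φ ∧
      (Literature.Analysis.FluidPDE.HasTypeITimeDecay C U ∧
        ContinuousOn (Function.uncurry U) (Set.Iio (0 : ℝ) ×ˢ Set.univ) ∧
        (∀ s t : ℝ, s < t → t < 0 → ∀ x, U t x =
          Literature.Analysis.UnboundedOperators.heatExtension (U s) (t - s) x -
            Literature.Analysis.FluidPDE.oseenDuhamel 1 s U U t x) ∧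
        (∀ t < 0, Literature.Analysis.FluidPDE.VectorCalculus.IsDivFree (U t)) ∧
        (∀ s < 0, ∀ q, ⟪Literature.Analysis.FluidPDE.curl (U s) q, EuclideanSpace.single 2 1⟫_ℝ = 0) ∧
        U (-1) 0 2 ≠ 0 ∧ (∀ t < 0, ∀ x, Real.sqrt (-t) * |U t x 2| ≤ |U (-1) 0 2|) ∧
        (∀ h : EuclideanSpace ℝ (Fin 3), fderiv ℝ (U (-1)) 0 h 2 = 0) ∧
        (deriv (fun s => U s 0 2) (-1) = U (-1) 0 2 / 2 ∧ U (-1) 0 2 * (Δ (fun q => U (-1) q 2)) 0 ≤ 0)) ∧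
      (∀ (s z₀ σ M : ℝ) (K O : Set (EuclideanSpace ℝ (Fin 3))), s < 0 →
        ((σ = 1 ∨ σ = -1) ∧ IsCompact K ∧ K.Nonempty ∧ (∀ q ∈ K, q 2 = z₀ ∧ σ * U s q 2 = M) ∧
          IsOpen O ∧ K ⊆ O ∧ (∀ q ∈ O, q 2 = z₀ → σ * U s q 2 ≤ M) ∧
          (∀ q ∈ O, q 2 = z₀ → σ * U s q 2 = M → q ∈ K)) → False) ∧
      U (-1) 0 2 = v (-1) 0 2 ∧
      (∀ t < 0, TendstoLocallyUniformly (fun j x => v t (x + γ (sq (φ j)))) (U t) atTop) ∧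
      (∀ s, Tendsto (fun j => γ (sq (φ j) + s) - γ (sq (φ j))) atTop (𝓝 (Γ s))) ∧
      -- re-entry package
      (∀ y ∈ {y : EuclideanSpace ℝ (Fin 3) | y 2 = 0 ∧ U (-1) y 2 = U (-1) 0 2}, fderiv ℝ (fun x => U (-1) x 2) y = 0) ∧
      ContDiff ℝ ∞ Γ ∧ Γ 0 = 0 ∧ (∀ s, Γ s 2 = 0) ∧ (∀ s, ‖deriv Γ s‖ = 1) ∧ (∀ s, U (-1) (Γ s) 2 = U (-1) 0 2) ∧
      (∀ s, κ₀ ≤ -(fderiv ℝ (fderiv ℝ (fun y => σ * U (-1) y 2)) (Γ s)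
          (WithLp.toLp 2 ![-(deriv Γ s 1), deriv Γ s 0, 0]) (WithLp.toLp 2 ![-(deriv Γ s 1), deriv Γ s 0, 0]))) ∧
      -- (Q3∞): the cross-section maximum is CONSTANT along `Γ`, for all `|τ|,|z| < δ`
      (∀ τ z : ℝ, |τ| < δ → |z| < δ → ∃ R₀ : ℝ, ∀ s : ℝ,
        sSup ((fun n : ℝ => σ * U (-1 + τ) (Γ s + n • WithLp.toLp 2 ![-(deriv Γ s 1), deriv Γ s 0, 0] + z • EuclideanSpace.single 2 1) 2) ''
          Icc (-r) r) = R₀) := by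
  obtain ⟨hrate, hcont, hmild, hdivf, hpol, hN, hpin, hgrad0, hpins⟩ := hP
  have hneg : (-1 : ℝ) < 0 := by norm_num
  set e₂ : EuclideanSpace ℝ (Fin 3) := EuclideanSpace.single 2 1 with he₂
  -- ## the signed slice at `t = −1` and the curvature of the branch
  have hslice : ContDiff ℝ ∞ (v (-1)) := (analyticOnNhd_slice hcont (bdd_of_hasTypeITimeDecay hrate) hmild hneg).contDiff
  set f : EuclideanSpace ℝ (Fin 3) → ℝ := fun y => σ * v (-1) y 2 with hfdef
  have hf : ContDiff ℝ ∞ f := contDiff_signed hslice σ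
  have hfC₃ : ∀ x, ‖iteratedFDeriv ℝ 3 f x‖ ≤ C₃ := fun x => (norm_iteratedFDeriv_signed_le hslice hσ 3 x).trans (hC₃ x)
  have hcritv := fderiv_two_eq_zero_of_hot (U := v) hpin
  have hv2d : Differentiable ℝ (fun y => v (-1) y 2) :=
    ((contDiff_piLp_apply (p := 2) (𝕜 := ℝ) (E := fun _ : Fin 3 => ℝ) (i := (2 : Fin 3))).comp hslice).differentiable (by simp)
  have hfcrit : ∀ s, fderiv ℝ f (γ s) = 0 := fun s => by
    rw [hfdef, fderiv_const_mul (hv2d _), hcritv (γ s) ⟨hplane s, hhot s⟩, smul_zero]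
  have hBcurv : ∀ s, ‖deriv (deriv γ) s‖ ≤ C₃ / κ₀ :=
    norm_deriv_deriv_le_of_critical_planeBranch (hf.of_le (by exact WithTop.coe_le_coe.2 le_top)) le_rfl hγ2 hplane hunit hfcrit hν hκ₀
      (fun s => by linarith [hκ s]) (fun s => hfC₃ (γ s))
  have hγd : Differentiable ℝ γ := hγ2.differentiable (by norm_num)
  have hγ'c : Continuous (deriv γ) := hγ2.continuous_deriv (by norm_num)
  -- ## the planar tube map, continuous and open on the strip `ℝ × (−r, r)`
  set Φ : ℝ × ℝ → ℝ × ℝ := fun p => ((γ p.1 0 + p.2 * (-(deriv γ p.1 1)), γ p.1 1 + p.2 * deriv γ p.1 0) : ℝ × ℝ) with hΦ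
  have hΦcont : Continuous Φ := by
    have h0 : Continuous fun a : ℝ => γ a 0 := (EuclideanSpace.proj (𝕜 := ℝ) (0 : Fin 3)).continuous.comp hγ2.continuous
    have h1 : Continuous fun a : ℝ => γ a 1 := (EuclideanSpace.proj (𝕜 := ℝ) (1 : Fin 3)).continuous.comp hγ2.continuous
    have hd0 : Continuous fun a : ℝ => deriv γ a 0 := (EuclideanSpace.proj (𝕜 := ℝ) (0 : Fin 3)).continuous.comp hγ'c
    have hd1 : Continuous fun a : ℝ => deriv γ a 1 := (EuclideanSpace.proj (𝕜 := ℝ) (1 : Fin 3)).continuous.comp hγ'c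
    exact ((h0.comp continuous_fst).add (continuous_snd.mul (hd1.comp continuous_fst).neg)).prodMk
      ((h1.comp continuous_fst).add (continuous_snd.mul (hd0.comp continuous_fst)))
  have hopen : ∀ b₁ b₂ : ℝ, IsOpen (Φ '' (Ioo b₁ b₂ ×ˢ Ioo (-r) r)) := fun b₁ b₂ =>
    isOpen_image_planarTube hγ2 hplane hunit hBcurv hrB (fun p => rfl) (isOpen_Ioo.prod isOpen_Ioo) (prod_mono (subset_univ _) Subset.rfl)
  -- the tube map read in the plane `{y₂ = z}` IS `γ a + n ν a + z e₂`
  have hPΦ : ∀ z a n : ℝ, (WithLp.toLp 2 ![(Φ (a, n)).1, (Φ (a, n)).2, z] : EuclideanSpace ℝ (Fin 3)) = γ a + n • ν a + z • e₂ := by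
    intro z a n
    ext i
    fin_cases i <;> simp [hΦ, hν, he₂, hplane a]
  -- ## the hull limit with its re-entry package
  obtain ⟨φ, U, Γ, hφ, hPU, hKU, hUN, hconv, hptγ, hptγ', -, hcritU, hΓs, hΓ0, hΓplane, hΓunit, hΓhot, hκU⟩ :=
    exists_hullLimit_branch_reentry C v ⟨hrate, hcont, hmild, hdivf, hpol, hN, hpin, hgrad0, hpins⟩ hK hσ hγ2 hplane hunit hhot hν hκ₀ hκ sq
  have hptν : ∀ s, Tendsto (fun j => ν (sq (φ j) + s)) atTop (𝓝 (WithLp.toLp 2 ![-(deriv Γ s 1), deriv Γ s 0, 0])) := fun s => by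
    have h := (continuous_planeNormal.tendsto (deriv Γ s)).comp (hptγ' s)
    have e : (fun j => ν (sq (φ j) + s)) =
        (fun u : EuclideanSpace ℝ (Fin 3) => (WithLp.toLp 2 ![-(u 1), u 0, 0] : EuclideanSpace ℝ (Fin 3))) ∘ fun j => deriv γ (sq (φ j) + s) := by
      funext j; simp only [Function.comp_apply, hν]
    rw [e]; exact h
  refine ⟨φ, U, Γ, hφ, hPU, hKU, hUN, hconv, hptγ, hcritU, hΓs, hΓ0, hΓplane, hΓunit, hΓhot, hκU, fun τ z hτ hz => ?_⟩
  -- ## fix `(τ, z)`; the time `t = −1 + τ < 0`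
  set t : ℝ := -1 + τ with ht
  have hτ' : τ < 1 / 2 := lt_of_lt_of_le (abs_lt.1 hτ).2 hδ1
  have htneg : t < 0 := by rw [ht]; linarith
  have hvtc : Continuous (v t) := continuous_slice_of_class hrate hcont hmild hdivf htneg
  have hvtc2 : Continuous fun y => v t y 2 := (EuclideanSpace.proj (𝕜 := ℝ) (2 : Fin 3)).continuous.comp hvtc
  -- the observable along the original branch
  set R : ℝ → ℝ := fun s => sSup ((fun n : ℝ => σ * v t (γ s + n • ν s + z • e₂) 2) '' Icc (-r) r) with hR
  -- (a) quasiconvex on every parameter interval (chart-free (Q1))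
  have hP' : ∀ q : ℝ × ℝ, (fun q : ℝ × ℝ => (WithLp.toLp 2 ![q.1, q.2, z] : EuclideanSpace ℝ (Fin 3))) q = WithLp.toLp 2 ![q.1, q.2, z] := fun q => rfl
  have hqc : ∀ b, (0 : ℝ) ≤ b → QuasiconvexOn ℝ (Icc 0 b) R := by
    intro b _
    have hlat' : ∀ a ∈ Icc (0 : ℝ) b, ∀ n : ℝ, (n = r ∨ n = -r) →
        σ * v t ((fun q : ℝ × ℝ => (WithLp.toLp 2 ![q.1, q.2, z] : EuclideanSpace ℝ (Fin 3))) (Φ (a, n))) 2 < m τ z := by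
      intro a _ n hn
      simpa only [hPΦ z a n] using hlat τ z hτ hz a n hn
    have hmid' : ∀ a ∈ Icc (0 : ℝ) b, m τ z ≤ σ * v t ((fun q : ℝ × ℝ => (WithLp.toLp 2 ![q.1, q.2, z] : EuclideanSpace ℝ (Fin 3))) (Φ (a, 0))) 2 := by
      intro a _
      simpa only [hPΦ z a 0, zero_smul, add_zero] using hmid τ z hτ hz a
    have h := crossSectionMax_quasiconvexOn_of_isOpen hK htneg hσ hvtc2 hP' hr.le hΦcont.continuousOn (fun b₁ b₂ _ _ => hopen b₁ b₂) hlat' hmid'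
    have e : (fun a => sSup ((fun n : ℝ => σ * v t ((fun q : ℝ × ℝ => (WithLp.toLp 2 ![q.1, q.2, z] : EuclideanSpace ℝ (Fin 3))) (Φ (a, n))) 2) '' Icc (-r) r)) = R := by
      funext a; simp only [hR, hPΦ z a]
    rw [e] at h
    exact h
  -- (b) bounded: `|σ v₂(t,y)| ≤ 2|N|` for `t ∈ (−3/2, −1/2)` by the Type-I extremality at the pin
  have hval : ∀ y, |σ * v t y 2| ≤ 2 * |v (-1) 0 2| := by
    intro y
    have h := hpin t htneg y
    have hst : (1 / 2 : ℝ) ≤ Real.sqrt (-t) := by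
      rw [show (1 / 2 : ℝ) = Real.sqrt (1 / 4) by rw [show (1 / 4 : ℝ) = (1 / 2) ^ 2 by norm_num, Real.sqrt_sq (by norm_num)]]
      exact Real.sqrt_le_sqrt (by rw [ht]; linarith [(abs_lt.1 hτ).1, (abs_lt.1 hτ).2])
    have hσ1 : |σ| = 1 := by rcases hσ with h | h <;> simp [h]
    rw [abs_mul, hσ1, one_mul]
    nlinarith [abs_nonneg (v t y 2), abs_nonneg (v (-1) 0 2)]
  have hbound : ∀ s, (0 : ℝ) ≤ s → |R s| ≤ 2 * |v (-1) 0 2| := by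
    intro s _
    have hne : ((fun n : ℝ => σ * v t (γ s + n • ν s + z • e₂) 2) '' Icc (-r) r).Nonempty := ⟨_, 0, ⟨by linarith, hr.le⟩, rfl⟩
    have hbdd : BddAbove ((fun n : ℝ => σ * v t (γ s + n • ν s + z • e₂) 2) '' Icc (-r) r) :=
      ⟨2 * |v (-1) 0 2|, by rintro _ ⟨n, -, rfl⟩; exact (le_abs_self _).trans (hval _)⟩
    rw [abs_le]
    constructor
    · have h0 : σ * v t (γ s + (0 : ℝ) • ν s + z • e₂) 2 ≤ R s := le_csSup hbdd ⟨0, ⟨by linarith, hr.le⟩, rfl⟩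
      linarith [neg_abs_le (σ * v t (γ s + (0 : ℝ) • ν s + z • e₂) 2), hval (γ s + (0 : ℝ) • ν s + z • e₂)]
    · exact csSup_le hne (by rintro _ ⟨n, -, rfl⟩; exact (le_abs_self _).trans (hval _))
  -- (c) the limit at `+∞`
  obtain ⟨L, hL⟩ := exists_tendsto_ridgeCoeff hqc hbound
  refine ⟨L, fun s => ?_⟩
  -- (d) the shifted observables converge to the observable of the hull limit
  have hV : TendstoLocallyUniformly (fun j x => v t (x + γ (sq (φ j)))) (U t) atTop := hconv t htneg
  have hVc : ∀ j, Continuous fun x => v t (x + γ (sq (φ j))) := fun j => hvtc.comp (continuous_id.add continuous_const)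
  have hUtc : Continuous (U t) := continuous_slice_of_class hPU.1 hPU.2.1 hPU.2.2.1 hPU.2.2.2.1 htneg
  have h := tendsto_crossSectionMax hV hVc hUtc (hptγ s) (hptν s) σ (z • e₂) hr.le
  have ek : ∀ (k : ℕ) (n : ℝ), γ (sq (φ k) + s) - γ (sq (φ k)) + n • ν (sq (φ k) + s) + z • e₂ + γ (sq (φ k)) =
      γ (sq (φ k) + s) + n • ν (sq (φ k) + s) + z • e₂ := fun k n => by abel
  have h2 : Tendsto (fun k => R (sq (φ k) + s)) atTop
      (𝓝 (sSup ((fun n : ℝ => σ * U t (Γ s + n • WithLp.toLp 2 ![-(deriv Γ s 1), deriv Γ s 0, 0] + z • e₂) 2) '' Icc (-r) r))) := by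
    refine h.congr fun k => ?_
    simp only [hR, ek]
  -- (e) abstract homogenisation
  exact eq_lim_of_tendsto_shift (Ψ := fun k a => R (sq (φ k) + a))
    (Ψl := fun a => sSup ((fun n : ℝ => σ * U t (Γ a + n • WithLp.toLp 2 ![-(deriv Γ a 1), deriv Γ a 0, 0] + z • e₂) 2) '' Icc (-r) r))
    (a := s) hL (hsq.comp hφ.tendsto_atTop) (Eventually.of_forall fun k => rfl) h2

end Summit.NavierStokesRegularity.NavierStokesRegularity.Theorems.PoloidalWindowDoorLrcModEntireRidgeHullValues

end
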